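import Summits.QuantumFields.YangMills.Theorems.F4SubCurvatureDoorShortRootRigidityPlanarConeSupportHolds
import Summits.QuantumFields.YangMills.Theorems.F4SubCurvatureDoorShortRootRigidityConePackaging
import Summits.QuantumFields.YangMills.Theorems.F4SubCurvatureDoorGlobalReductionCertificate
import Summits.QuantumFields.YangMills.Theorems.F4SubCurvatureDoorShortRootRigiditySliceInClass
import Summits.QuantumFields.YangMills.Theorems.F4SubCurvatureDoorAngularContinuation
import Summits.QuantumFields.YangMills.Theorems.F4SubCurvatureDoorPeriodicEntireRigidity
import Mathlib
import HarnessLib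

/-!
# Crux ⟨stmt-QuantumFields-23035⟩ `F4SubCurvatureDoor.ShortRootRigidity` — «PLANAR RIGIDITY» BY NAME, and the crux modulo the ONE remaining stub

Skeleton `Cruxes/ShortRootRigidity/Lines/aperture_bootstrap.lean` (planner ym-idea-3 g21, commit cba045e6138d).  After the registered stubs
`:128` (p723566), `:132` (p723250), `:137` (p724234) (this seat) and `:141` (p723376, width seat w3 g38) landed BY NAME, the skeleton's
PROVED compositions become tree theorems:

* `planarRigidity_holds : PlanarRigidity` — obligation (2) of LINE g19-A BY NAME: **every kernel of the planar class is `O(2)`-invariant off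
  `0`** (the two-dimensional rigidity theorem): (C) for all planar-class kernels (`:141` ∘ `planarConeSupport_holds`) + the landed (A)
  `stub_angularContinuation` + (P) `stub_periodicEntireRigidity` (the owner's `planarRigidity_of_cone`, re-proved verbatim);
* `shortRootRigidity_of_oddModeRigidity : OddModeRigidity → ShortRootRigidity` — **the crux BY NAME modulo the single remaining shared stub
  `stub_oddModeRigidity`** (the owner's `shortRootRigidity_of_pieces` with the four landed pieces, over `stub_sliceDensity` ✓,
  `stub_sliceInClass` ✓ and the certificate `shortRootRigidity_of_global`).

(C) BY NAME itself (`∀ k, InPlanarClass k → PlanarSpectralCone k`) is w3 g38's capstone over `:141`; here it is only used inline.  The Props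
`PlanarRigidity`, `OddModeRigidity` are NOT re-declared: both theorems carry their bodies UNFOLDED (character-identical).  HONEST LABEL: ⟨23035⟩ is NOT closed (OddModeRigidity's residual
`NP_j(0) ∨ NP_j(3)`, `j ≥ 7`, is open — `transverse_slice_stubplans.md`); ⟨23125⟩, R2d and the Yang–Mills mass gap remain OPEN; no summit is
proved by a line.  Lead seat `ym-line-sfw-p2` g75 (cell ym-idea-1, free hands).
-/

set_option autoImplicit false

noncomputable section

namespace Summit.QuantumFields.YangMills.Theorems.F4SubCurvatureDoorPlanarRigidityByName

open scoped Topology BigOperators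
open Filter Set MeasureTheory
open Literature.MathematicalPhysics.QuantumLattice (timeReflection siteToE)
open Summit.QuantumFields.YangMills.Cruxes.OSLegsAtWeakCouplingC.Sketch (IsSignedPerm)
open Summit.QuantumFields.YangMills.Theorems.F4SubCurvatureDoorMirrorAnalyticityRegistered (E4 InClass)
open Summit.QuantumFields.YangMills.Theorems.F4SubCurvatureDoorSliceDensityRegistered
  (E2 slice EvenPartSliceInvariant SliceDensity stub_sliceDensity)
open Summit.QuantumFields.YangMills.Theorems.F4SubCurvatureDoorSliceInClassRegistered
  (hexReflection InPlanarClass SliceInClass stub_sliceInClass)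
open Summit.QuantumFields.YangMills.Cruxes.ShortRootRigidity.AngularType
  (mk2 polar fwdTube PlanarSpectralConeFrame AngularContinuation PeriodicEntireRigidity
   stub_angularContinuation stub_periodicEntireRigidity)
open Summit.QuantumFields.YangMills.Theses.F4SubCurvatureDoor (ShortRootRigidity)
open Summit.QuantumFields.YangMills.Theorems.F4SubCurvatureDoorConePackagingRegistered (PlanarSpectralCone stub_planarSpectralCone_of_coneSupport)
open Summit.QuantumFields.YangMills.Theorems.F4SubCurvatureDoorPlanarConeSupportByName (planarConeSupport_holds)

/-! ## Statement shapes

No `def`s are introduced: the two Props of the skeleton are used UNFOLDED (their bodies character-identical with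
`Lines/aperture_bootstrap.lean` :118 `PlanarRigidity` and :122 `OddModeRigidity`), so that `planarRigidity_holds` is, by `δ`-reduction, a term
of type `PlanarRigidity` for every file that restates that Prop verbatim. -/

/-! ## The owner's compositions (planner ym-idea-3 g21), re-proved verbatim over the landed pieces -/

/-- `mk2` eta. -/
theorem mk2_eta (y : E2) : mk2 (y 0) (y 1) = y := by
  ext i; fin_cases i <;> simp [mk2]

/-- Norm squared in coordinates. -/
theorem norm_sq_eq (y : E2) : ‖y‖ ^ 2 = y 0 ^ 2 + y 1 ^ 2 := by
  rw [EuclideanSpace.real_norm_sq_eq, Fin.sum_univ_two]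

/-- Polar form of a non-zero planar vector. [bookkeeping] -/
theorem exists_polar {y : E2} (hy : y ≠ 0) : ∃ φ : ℝ, y = polar ‖y‖ φ := by
  have hr : 0 < ‖y‖ := norm_pos_iff.mpr hy
  set w : ℂ := ⟨y 0, y 1⟩ with hw
  have hnorm : ‖w‖ = ‖y‖ := by
    rw [Complex.norm_def, Complex.normSq_mk, ← sq, ← sq, ← norm_sq_eq]
    exact Real.sqrt_sq hr.le
  have hw0 : w ≠ 0 := by
    intro h0; rw [h0, norm_zero] at hnorm; linarith
  refine ⟨Complex.arg w, ?_⟩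
  have hc : y 0 = ‖y‖ * Real.cos (Complex.arg w) := by
    have := Complex.cos_arg hw0
    rw [hnorm] at this
    field_simp at this
    simpa [hw, mul_comm] using this.symm
  have hs : y 1 = ‖y‖ * Real.sin (Complex.arg w) := by
    have := Complex.sin_arg w
    rw [hnorm] at this
    field_simp at this
    simpa [hw, mul_comm] using this.symm
  rw [polar, ← hc, ← hs, mk2_eta]

/-- The angular-type assembly with the LANDED (A) and (P): (C) for all planar class kernels ⇒ planar rigidity. [problem-side composition] -/
theorem planarRigidity_of_cone (hcone : ∀ k : E2 → ℝ, InPlanarClass k → PlanarSpectralCone k) :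
    ∀ k : E2 → ℝ, InPlanarClass k → ∀ (R : E2 ≃ₗᵢ[ℝ] E2) (y : E2), y ≠ 0 → k (R y) = k y := by
  intro k hk R y hy
  have hr : 0 < ‖y‖ := norm_pos_iff.mpr hy
  have hRy : R y ≠ 0 := fun h => hy (by simpa using congrArg R.symm h)
  obtain ⟨φ, hφ⟩ := exists_polar hy
  obtain ⟨φ', hφ'⟩ := exists_polar hRy
  rw [LinearIsometryEquiv.norm_map] at hφ'
  obtain ⟨G, hG, hGk, hGper, hGgrowth⟩ := stub_angularContinuation k hk (hcone k hk) ‖y‖ hr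
  have hconst : G (φ' : ℂ) = G (φ : ℂ) := stub_periodicEntireRigidity G hG hGper hGgrowth φ' φ
  rw [hGk, hGk] at hconst
  calc k (R y) = k (polar ‖y‖ φ') := by rw [hφ']
    _ = k (polar ‖y‖ φ) := by exact_mod_cast hconst
    _ = k y := by rw [← hφ]

/-- ★★★ **«PLANAR RIGIDITY»** (obligation (2) of LINE g19-A; the body of the skeleton's `PlanarRigidity`, so this IS `PlanarRigidity` by name up to
unfolding): every kernel of the planar class is `O(2)`-invariant off the origin — UNCONDITIONAL. -/
theorem planarRigidity_holds :
    ∀ k : E2 → ℝ, InPlanarClass k → ∀ (R : E2 ≃ₗᵢ[ℝ] E2) (y : E2), y ≠ 0 → k (R y) = k y :=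
  planarRigidity_of_cone (stub_planarSpectralCone_of_coneSupport fun k μ hk hμ => planarConeSupport_holds k μ hk hμ)

/-- **The crux ⟨23035⟩ `ShortRootRigidity` BY NAME modulo the single remaining stub `OddModeRigidity`** (hypothesis = the body of the
skeleton's `OddModeRigidity`, verbatim): the owner's `shortRootRigidity_of_pieces` with every other piece a landed tree theorem.
CONDITIONAL on that one open stub — credits nothing by itself. -/
theorem shortRootRigidity_of_oddModeRigidity
    (hodd : ∀ K : E4 → ℝ, InClass K → EvenPartSliceInvariant K → ∀ (R : E4 ≃ₗᵢ[ℝ] E4) (x : E4), K (R x) = K x) :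
    ShortRootRigidity :=
  Summit.QuantumFields.YangMills.Theorems.F4SubCurvatureDoorGlobalReduction.shortRootRigidity_of_global
    (fun K hK hbd hB hRP hbud hlat =>
      hodd K ⟨hK, hbd, hB, hRP, hbud, hlat⟩
        (stub_sliceDensity K ⟨hK, hbd, hB, hRP, hbud, hlat⟩ (fun a R y hy =>
          planarRigidity_holds (slice K a) (stub_sliceInClass K ⟨hK, hbd, hB, hRP, hbud, hlat⟩ a) R y hy)))

end Summit.QuantumFields.YangMills.Theorems.F4SubCurvatureDoorPlanarRigidityByName

end
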